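import Summits.QuantumFields.YangMills.Theorems.LuscherReductionTwistedTraceScalingShellLogAssembly
import HarnessLib

/-!
# R4 — THE VALLEY GAIN WITH LOG RATE AT RED's LEDGER: `ValleyGainLogAt L (β^{−1/40}) (β^{−17/20})` UNCONDITIONAL for `L ≥ 2`
# (lane A of S-BASE, crux `TwistedTraceScaling` stmt-QuantumFields-20203, line «twolattice», stub `stub_fixedLatticeTraceLaw`; hand A for lead g24; card `Lines-window-floor.md` §3 R4)

The log-rate twin of RED's ✓`valleyGainAt_ledger` chain.  The MECHANISM has a power rate: the Schur-test row bound of ✓`valleyKernelRowBoundAt_of_boWeak_geom` spends the valley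
gain `gain1Slope·c₀·δ(β)` (`δ = β^{−p}`) against `A·λ_b(L³β)`, and `(c·log β)·λ_b(L³β) = o(β^{−p})` for every `p < 1/3` (R1 ✓`log_mul_bareLambda_le_powScale`); only the
exported text `∀ A, ∃ β₀` lost the rate (cdisprove R72 (5)).  This file carries `A ↦ c·log β` through the same composition (no new definition: the covariant row bound
with log rate is stated inline):
* ★★★ `valleyKernelRowBoundLog_of_boWeak_geom : ValleyBOWeakAt L δ η → ValleyGeomAt L δ η → (∀ β, 0 < δ β) → (∀ M, ∃ β₀, ∀ β ≥ β₀, M·log β·λ_b(L³β) ≤ δ β) →`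
  ⟨for every `c`, eventually a bounded measurable weight `h ≥ 0`, `h ≥ c' > 0` on the valley set, with `∫_{valley} K_β(U,·)h ≤ e^{−(c·log β)λ_b(L³β)}·λ₀·h(U)` on the valley set⟩;
* ★★ `valleyGainLogAt_of_kernelRowBoundLog` — the Schur door (✓`qform_le_of_kernelRow`) with log rate;
* ★★ `valleyGainLogAt_of_floor_pow` — `0 < p < 1/3`, `4p < q`, `0 < r`, `2r < 1`, `0 < m`, `2r < q − m/2`: RED's k = 0 FLOOR(N_B) ⇒ `ValleyGainLogAt L (β^{−p}) (β^{−q})`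
  (✓`valleyBOWeakAt_of_floor_pow` + ✓`valleyGeomAt_pow` + the two theorems above);
* ★★★ `valleyGainLog_pow_of_two_le` / ★★★ `valleyGainLog_fortieth (hL : 2 ≤ L) : ValleyGainLogAt L (powScale (1/40)) (powScale (17/20))` — UNCONDITIONAL (RED's landed floor
  ✓`valleyFloorAt_of_idealCmp_pow` + ✓`riccatiN_idealCmp_pow` at the ledger `(r, m) = (41/100, 11/200)`).
HONEST FRAMING: fixed lattice size `L ≥ 2`, eventually in `β`; a re-export with rate of RED's kernel-checked valley chain, for W(L) of stub S-BASE of a child of the CONDITIONAL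
reduction route R2b1; W(L), `stub_cmpTwoLoop`, `stub_labelTracking` and the crux `TwistedTraceScaling` are OPEN; not infinite volume, not a mass gap, not Clay.  No definitions, no `sorry`.
-/

set_option autoImplicit false

noncomputable section

open MeasureTheory Filter Topology Real Module
open scoped BigOperators InnerProductSpace
open Literature.MathematicalPhysics.QuantumFieldTheory
open Literature.MathematicalPhysics.QuantumLattice

namespace Summit.QuantumFields.YangMills.Theorems.FemtoTransferGap

open TwoLattice TwoLattice.Toron TwoLattice.Cov TwoLattice.Stiff

variable {L : ℕ} [NeZero L]

/-! ## §1 The C3 composition with log rate -/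

/-- ★★★ **THE C3 SKELETON WITH LOG RATE, weak currency**: `ValleyBOWeakAt L δ η → ValleyGeomAt L δ η → (∀ M, eventually M·log β·λ_b(L³β) ≤ δ β) →` the covariant valley row
bound with rate `e^{−(c·log β)·λ_b(L³β)}` for every `c`.  The proof of ✓`valleyKernelRowBoundAt_of_boWeak_geom` verbatim, the scale condition now reading
`(c log β)·λ_b ≤ gain1Slope·c₀·δ(β)`. [cite: Luscher1983, §3] [cite: LuscherMunster1984, §2] -/
theorem valleyKernelRowBoundLog_of_boWeak_geom {δ η : ℝ → ℝ} (hBO : ValleyBOWeakAt L δ η) (hG : ValleyGeomAt L δ η) (hδ0 : ∀ β, 0 < δ β)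
    (hδ : ∀ M : ℝ, ∃ β0 : ℝ, ∀ β : ℝ, β0 ≤ β → M * Real.log β * bareLambda ((L : ℝ) ^ 3 * β) ≤ δ β) :
    ∀ cR : ℝ, ∃ β0 : ℝ, ∀ β : ℝ, β0 ≤ β →
      ∃ (h : GaugeConfig 3 L SU2 → ℝ) (c C : ℝ), Measurable h ∧ 0 < c ∧ (∀ U, 0 ≤ h U) ∧ (∀ U ∈ valleySet L (δ β) (η β), c ≤ h U) ∧ (∀ U, h U ≤ C) ∧
        ∀ U ∈ valleySet L (δ β) (η β),
          ∫ V, (valleySet L (δ β) (η β)).indicator (fun V => transferKernel su2Rep β U V * h V) V ∂configMeasure SU2 L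
            ≤ Real.exp (-(cR * Real.log β * bareLambda ((L : ℝ) ^ 3 * β))) * levelValue su2Rep L β 0 * h U := by
  intro cR
  obtain ⟨κ, hκ, hbo⟩ := hBO
  obtain ⟨c₀, hc₀, hgeom⟩ := hG
  -- constants
  set n : ℕ := Fintype.card (Edge 3 L) * 3 with hn
  set gS : ℝ := gain1Slope L κ with hgS
  have hgS0 : 0 < gS := gain1Slope_pos L hκ
  -- the geometry tolerance: Lipschitz loss ≤ half the gain, `n√(κ/2)·εG ≤ 2 gS c₀`
  set εG : ℝ := 2 * gS * c₀ / ((n : ℝ) * Real.sqrt (κ / 2) + 1) with hεG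
  have hden : 0 < (n : ℝ) * Real.sqrt (κ / 2) + 1 := by positivity
  have hεG0 : 0 < εG := by rw [hεG]; positivity
  have hεGle : (n : ℝ) * (Real.sqrt (κ / 2) * εG) ≤ 2 * gS * c₀ := by
    rw [hεG]
    have : (n : ℝ) * (Real.sqrt (κ / 2) * (2 * gS * c₀ / ((n : ℝ) * Real.sqrt (κ / 2) + 1))) =
        ((n : ℝ) * Real.sqrt (κ / 2)) / ((n : ℝ) * Real.sqrt (κ / 2) + 1) * (2 * gS * c₀) := by
      field_simp
    rw [this]
    have hfrac : ((n : ℝ) * Real.sqrt (κ / 2)) / ((n : ℝ) * Real.sqrt (κ / 2) + 1) ≤ 1 := by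
      rw [div_le_one hden]; linarith
    have h2 : 0 ≤ 2 * gS * c₀ := by positivity
    exact mul_le_of_le_one_left h2 hfrac
  -- the BO tolerance: a quarter of the gain on each side
  have hεB0 : 0 < gS * c₀ / 2 := by positivity
  obtain ⟨βB, hB⟩ := hbo (gS * c₀ / 2) hεB0
  obtain ⟨βG, hGe⟩ := hgeom εG hεG0
  obtain ⟨βM, hM⟩ := hδ (cR / (gS * c₀))
  refine ⟨max βB (max βG βM), fun β hβ => ?_⟩
  have hβB : βB ≤ β := (le_max_left _ _).trans hβ
  have hβG : βG ≤ β := ((le_max_left _ _).trans (le_max_right _ _)).trans hβ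
  have hβM : βM ≤ β := ((le_max_right _ _).trans (le_max_right _ _)).trans hβ
  obtain ⟨N, hN, hfloor, h, c, Ch, hhm, hc, hh0, hhC, hhc, hrow⟩ := hB β hβB
  refine ⟨h, c, Ch, hhm, hc, hh0, hhc, hhC, fun U hU => ?_⟩
  have hhC' : ∀ V, |h V| ≤ Ch := fun V => by rw [abs_of_nonneg (hh0 V)]; exact hhC V
  refine (integral_indicator_kernel_le_transferApply (measurableSet_valleySet (δ β) (η β)) hhm hh0 hhC' U).trans ?_
  refine (hrow U hU).trans ?_
  -- the zero-point sum at `U`: vacuum + gain − Lipschitz loss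
  obtain ⟨g, θ, k, hnear, hfar⟩ := hGe β hβG U hU
  classical
  have hdiag := Frame.isDiag_eigenvectorBasis (covCurl U) (finrank_linkSpace L)
  have hδβ : 0 ≤ δ β := (hδ0 β).le
  have hδpos : 0 ≤ εG * δ β := mul_nonneg hεG0.le hδβ
  have hzpe := sum_modeZPE_ge_vacuum_add_gain_of_near L g θ hdiag hκ hδpos hnear k
  rw [sum_modeZPE_eq_zpeSum L hdiag κ] at hzpe
  have hloss : ((Fintype.card (Edge 3 L) * 3 : ℕ) : ℝ) * (Real.sqrt (κ / 2) * (εG * δ β)) ≤ 2 * gS * c₀ * δ β := by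
    have := mul_le_mul_of_nonneg_right hεGle hδβ
    have e : ((Fintype.card (Edge 3 L) * 3 : ℕ) : ℝ) * (Real.sqrt (κ / 2) * (εG * δ β)) = (n : ℝ) * (Real.sqrt (κ / 2) * εG) * δ β := by
      rw [hn]; ring
    rw [e]; exact this
  have hgain : 4 * (gS * (c₀ * δ β)) ≤ 4 * (gS * ‖((2 * θ k : ℝ) : AddCircle (2 * Real.pi / L))‖) :=
    mul_le_mul_of_nonneg_left (mul_le_mul_of_nonneg_left hfar hgS0.le) (by norm_num)
  have hz : 6 * toronZPE L κ 0 0 + 2 * gS * c₀ * δ β ≤ zpeSum L κ U := by rw [hgS] at hgain hloss ⊢; linarith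
  -- the scale condition with LOG RATE: `gS c₀ δ ≥ (cR log β) λ_b`
  set A : ℝ := cR * Real.log β with hA
  have hscale : A * bareLambda ((L : ℝ) ^ 3 * β) ≤ gS * c₀ * δ β := by
    have h1 := hM β hβM
    have h2 : 0 < gS * c₀ := by positivity
    have e : cR / (gS * c₀) * Real.log β * bareLambda ((L : ℝ) ^ 3 * β) = A * bareLambda ((L : ℝ) ^ 3 * β) / (gS * c₀) := by
      rw [hA]; field_simp
    rw [e, div_le_iff₀ h2] at h1
    linarith
  -- assemble: `N e^{εδ} e^{−zpe} ≤ e^{−Aλ_b} λ₀`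
  set lam : ℝ := bareLambda ((L : ℝ) ^ 3 * β) with hlam
  set Z : ℝ := toronZPE L κ 0 0 with hZ
  set εδ : ℝ := gS * c₀ / 2 * δ β with hεδ
  have hl0 : 0 ≤ levelValue su2Rep L β 0 := le_trans (by positivity) hfloor
  have hE1 : Real.exp (A * lam + 2 * εδ - 2 * gS * c₀ * δ β) ≤ 1 := by
    rw [Real.exp_le_one_iff, hεδ]
    linarith
  have hexp : Real.exp εδ * Real.exp (-(6 * Z + 2 * gS * c₀ * δ β)) =
      Real.exp (-(6 * Z)) * Real.exp (-εδ) * (Real.exp (-(A * lam)) * Real.exp (A * lam + 2 * εδ - 2 * gS * c₀ * δ β)) := by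
    simp only [← Real.exp_add]; congr 1; ring
  have key : N * Real.exp εδ * Real.exp (-zpeSum L κ U) ≤ Real.exp (-(A * lam)) * levelValue su2Rep L β 0 := by
    calc N * Real.exp εδ * Real.exp (-zpeSum L κ U)
        ≤ N * Real.exp εδ * Real.exp (-(6 * Z + 2 * gS * c₀ * δ β)) :=
          mul_le_mul_of_nonneg_left (Real.exp_le_exp.mpr (by linarith)) (by positivity)
      _ = (N * Real.exp (-(6 * Z)) * Real.exp (-εδ)) * (Real.exp (-(A * lam)) * Real.exp (A * lam + 2 * εδ - 2 * gS * c₀ * δ β)) := by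
          rw [mul_assoc N, hexp]; ring
      _ ≤ levelValue su2Rep L β 0 * (Real.exp (-(A * lam)) * 1) :=
          mul_le_mul hfloor (mul_le_mul_of_nonneg_left hE1 (Real.exp_pos _).le) (by positivity) hl0
      _ = Real.exp (-(A * lam)) * levelValue su2Rep L β 0 := by ring
  exact mul_le_mul_of_nonneg_right key (hh0 U)

/-- ★★ **VALLEY GAIN WITH LOG RATE from a covariant valley row bound with log rate** (the weighted Schur test ✓`qform_le_of_kernelRow` on the valley set).
[cite: Grafakos2009, App. A.2] -/
theorem valleyGainLogAt_of_kernelRowBoundLog {δ η : ℝ → ℝ}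
    (hV : ∀ cR : ℝ, ∃ β0 : ℝ, ∀ β : ℝ, β0 ≤ β →
      ∃ (h : GaugeConfig 3 L SU2 → ℝ) (c C : ℝ), Measurable h ∧ 0 < c ∧ (∀ U, 0 ≤ h U) ∧ (∀ U ∈ valleySet L (δ β) (η β), c ≤ h U) ∧ (∀ U, h U ≤ C) ∧
        ∀ U ∈ valleySet L (δ β) (η β),
          ∫ V, (valleySet L (δ β) (η β)).indicator (fun V => transferKernel su2Rep β U V * h V) V ∂configMeasure SU2 L
            ≤ Real.exp (-(cR * Real.log β * bareLambda ((L : ℝ) ^ 3 * β))) * levelValue su2Rep L β 0 * h U) :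
    ValleyGainLogAt L δ η := by
  intro cR
  obtain ⟨β0, hβ0⟩ := hV cR
  refine ⟨max β0 0, fun β hβ φ hφ hsupp => ?_⟩
  have hβ' : β0 ≤ β := (le_max_left _ _).trans hβ
  have hβ0' : 0 ≤ β := (le_max_right _ _).trans hβ
  obtain ⟨h, c, C, hhm, hc, hh0, hch, hhC, hrow⟩ := hβ0 β hβ'
  obtain ⟨Cφ, hCφ⟩ := hφ.bounded
  have hsupp' : ∀ U, φ U ≠ 0 → U ∈ valleySet L (δ β) (η β) := fun U hU => hsupp U hU
  have hhC' : ∀ U, |h U| ≤ C := fun U => by rw [abs_of_nonneg (hh0 U)]; exact hhC U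
  have := qform_le_of_kernelRow hβ0' hφ.measurable hCφ (measurableSet_valleySet (δ β) (η β)) hsupp' hhm hc hch hhC'
    (Λ := Real.exp (-(cR * Real.log β * bareLambda ((L : ℝ) ^ 3 * β))) * levelValue su2Rep L β 0) (fun U hU => hrow U hU)
  linarith [this]

/-- ★★★ `ValleyBOWeakAt L (β^{−p}) (β^{−q}) → ValleyGeomAt L (β^{−p}) (β^{−q}) → ValleyGainLogAt L (β^{−p}) (β^{−q})` for `p < 1/3` (the log domination of `λ_b` by `β^{−p}` is
R1's ✓`log_mul_bareLambda_le_powScale`). [cite: Luscher1983, §3] [cite: LuscherMunster1984, §2] -/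
theorem valleyGainLogAt_of_boWeak_geom_pow {p q : ℝ} (hp : p < 1 / 3)
    (hBO : ValleyBOWeakAt L (powScale p) (powScale q)) (hG : ValleyGeomAt L (powScale p) (powScale q)) :
    ValleyGainLogAt L (powScale p) (powScale q) :=
  valleyGainLogAt_of_kernelRowBoundLog
    (valleyKernelRowBoundLog_of_boWeak_geom hBO hG (fun β => powScale_pos p β) fun M =>
      Filter.eventually_atTop.mp (TwoLattice.ConstTube.log_mul_bareLambda_le_powScale (L := L) hp M))

/-! ## §2 From RED's k = 0 floor; the ledger instance -/

/-- ★★ **VALLEY GAIN WITH LOG RATE from the k = 0 FLOOR** at polynomial scales: for `0 < p < 1/3`, `4p < q`, `0 < r`, `2r < 1`, `0 < m`, `2r < q − m/2`,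
`ValleyFloorAt L (powScale p) (1/2) N_B → ValleyGainLogAt L (powScale p) (powScale q)` (FLOOR ⇒ weak BO ✓`valleyBOWeakAt_of_floor_pow`, GEOMETRY ✓`valleyGeomAt_pow`).
[cite: Luscher1983, §3] [cite: LuscherMunster1984, §2] [cite: Grafakos2009, App. A.2] -/
theorem valleyGainLogAt_of_floor_pow {p q r m : ℝ} (hp0 : 0 < p) (hp : p < 1 / 3) (hpq : 4 * p < q) (hr : 0 < r) (hr1 : 2 * r < 1) (hm : 0 < m)
    (hrq : 2 * r < q - m / 2)
    (hF : ValleyFloorAt L (powScale p) (1 / 2) (fun β => riccatiN L β (powScale r β) (2 * powScale q β) (powScale m β))) :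
    ValleyGainLogAt L (powScale p) (powScale q) := by
  have hq0 : 0 < q := by linarith
  exact valleyGainLogAt_of_boWeak_geom_pow hp (FemtoCutoffLadder.valleyBOWeakAt_of_floor_pow hq0 hr hr1 hm hrq hF) (valleyGeomAt_pow hp0 hpq)

/-- ★★★ **VALLEY GAIN WITH LOG RATE for `L ≥ 2` at polynomial scales, UNCONDITIONALLY**: for `0 < p < 1/10`, `4p < q`, `0 < r`, `2r < 1`, `0 < m`, `2r < q − m/2`, `p < m/2`,
`1 + 3m − 3r < −p`: `ValleyGainLogAt L (powScale p) (powScale q)` — RED's k = 0 floor (✓`valleyFloorAt_of_idealCmp_pow` + ✓`riccatiN_idealCmp_pow`) fed into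
`valleyGainLogAt_of_floor_pow`. [cite: Luscher1983, §3] [cite: LuscherMunster1984, §2] -/
theorem valleyGainLog_pow_of_two_le (hL : 2 ≤ L) {p q r m : ℝ} (hp0 : 0 < p) (hp : p < 1 / 10) (hpq : 4 * p < q) (hr : 0 < r) (hr1 : 2 * r < 1)
    (hm : 0 < m) (hrq : 2 * r < q - m / 2) (hpm : p < m / 2) (hC : 1 + 3 * m - 3 * r < -p) :
    ValleyGainLogAt L (powScale p) (powScale q) :=
  valleyGainLogAt_of_floor_pow hp0 (by linarith) hpq hr hr1 hm hrq
    (valleyFloorAt_of_idealCmp_pow hL hp (riccatiN_idealCmp_pow (L := L) hp0 hpm (by linarith) hC hm.le))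

/-- ★★★ **`V_log(1/40)`**: `ValleyGainLogAt L (powScale (1/40)) (powScale (17/20))` for every `L ≥ 2`, at RED's ledger `(r, m) = (41/100, 11/200)`.
[cite: Luscher1983, §3] [cite: LuscherMunster1984, §2] -/
theorem valleyGainLog_fortieth (hL : 2 ≤ L) : ValleyGainLogAt L (powScale (1 / 40)) (powScale (17 / 20)) :=
  valleyGainLog_pow_of_two_le hL (r := 41 / 100) (m := 11 / 200) (by norm_num) (by norm_num) (by norm_num) (by norm_num) (by norm_num) (by norm_num)
    (by norm_num) (by norm_num) (by norm_num)

end Summit.QuantumFields.YangMills.Theorems.FemtoTransferGap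

end
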